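import Literature.NumberTheory.Sieve.SmoothNumbersRestrictedPrimes
import Mathlib.Data.Nat.Log
import Mathlib.Tactic.FieldSimp
import Mathlib.Tactic.Linarith
import Mathlib.Tactic.Positivity
import Mathlib.Tactic.Ring
import HarnessLib

/-!
# Smooth numbers with restricted prime factors: the Lenstra–Pomerance lower bound

The assembled lower bound of Lenstra–Pomerance, *A rigorous time bound for factoring integers*,
J. Amer. Math. Soc. **5** (1992), §6, Theorem 6.1 (pp. 499–500), in explicit non-asymptotic form.
For finite sets of primes `R, T ⊆ Q` with `R ∩ T = ∅`, all primes of `R` at most `w`, all primes of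
`T` in `[v, y]`, and integers `k, J, x` with `y ^ k ≤ x < v ^ k · w ^ (J + 1)`:

  `ψ(x; Q) ≥ x · S^k · (q / w)^J / (w · J! · k!)`,  `S = ∑_{p ∈ T} 1/p`, `q = #R`

(`card_factoredUpTo_ge`), where `ψ(x; Q) = #(factoredUpTo Q x)` counts the integers `1 ≤ n ≤ x`
all of whose prime factors lie in `Q`. This is (6.6)–(6.11) of the paper with the bookkeeping of
exponents left undone: there `Q = {p ≤ y : p ∈ 𝒫}`, `T = {p ∈ 𝒫 : v < p ≤ y}`,
`R = {p ∈ 𝒫 : p ≤ w}`, `k = [u]` with `u = log x / log y`, `J ≈ log(x / v^k) / log w`, and the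
hypotheses (6.4) `S ≥ 1/(α log u)`, `q ≥ w/(β log w)` turn the right-hand side into
`x · exp(-u (log u + log log u + log α + o(log u)))`, i.e. Theorem 6.1; for `𝒫 =` all primes this
is the Canfield–Erdős–Pomerance lower bound `ψ(x, y) ≥ x · u^{-u(1 + o(1))}` in the range
`y ≤ exp((log x)^{1/2} (log log x)^η)`, `η < 1`. The specialisation to the paper's interval sets is
`card_factoredUpTo_ge_of_filter`.

Proof (the paper's, per multiset `M` of `k` primes of `T`, `m = ∏ M`, `z = ⌊x/m⌋ ≥ 1`): with
`j = Nat.log w z` one has `w^j ≤ z < w^(j+1)`, so `ψ(z; R) ≥ #(R.sym j) ≥ q^j / j!`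
(`card_sym_le_card_factoredUpTo_of_pow_le`, `card_pow_le_factorial_mul_card_sym`), and
`q^j / j! = (q/w)^j w^j / j! ≥ (q/w)^J / J! · x / (m w)` because `w^(j+1) > x/m`, `j ≤ J` and
`q ≤ w`; summing over `M` with `∑_M 1/m ≥ S^k / k!` (`inv_sum_pow_le_factorial_mul_sum_sym_inv_prod`)
and the two-stage injection `∑_M ψ(⌊x/m⌋; R) ≤ ψ(x; Q)` (`sum_card_factoredUpTo_div_le`) gives the
claim. Everything is proved; no named facts.

## References

* H. W. Lenstra Jr., C. Pomerance, *A rigorous time bound for factoring integers*, J. Amer. Math.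
  Soc. 5 (1992) 483–516, §6, Theorem 6.1, (6.6)–(6.11). [LenstraPomerance1992]
* E. R. Canfield, P. Erdős, C. Pomerance, *On a problem of Oppenheim concerning "factorisatio
  numerorum"*, J. Number Theory 17 (1983) 1–28.
-/

namespace Literature.NumberTheory.Sieve

open Finset

/-- A finite set of primes all `≤ w` has at most `w` elements. [folklore] -/
theorem card_le_of_forall_prime_le {R : Finset ℕ} (hR : ∀ p ∈ R, p.Prime) {w : ℕ}
    (hRw : ∀ p ∈ R, p ≤ w) : #R ≤ w := by
  calc #R ≤ #(Finset.Icc 1 w) :=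
        card_le_card fun p hp => mem_Icc.2 ⟨(hR p hp).one_lt.le, hRw p hp⟩
    _ = w := by simp

/-- The per-multiset step of the proof of [LP92, Thm 6.1]: for `m ≥ 1` with `m ≤ x`,
`x / m < w ^ (J + 1)` (integer division) and all primes of `R` at most `w` (`w ≥ 2`),
`ψ(⌊x / m⌋; R) ≥ (q / w)^J / J! · x / (m · w)` with `q = #R`. (Take `j = Nat.log w ⌊x/m⌋`, so that
`w^j ≤ ⌊x/m⌋ < w^(j+1)`; then `ψ(⌊x/m⌋; R) ≥ #(R.sym j) ≥ q^j/j! = (q/w)^j w^j/j!`, and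
`w^j = w^(j+1)/w > x/(m w)`, `(q/w)^j/j! ≥ (q/w)^J/J!` as `j ≤ J`, `q ≤ w`.)
[cite: LenstraPomerance1992, §6 proof of Thm 6.1 (6.7)–(6.10)] -/
theorem card_factoredUpTo_div_ge {R : Finset ℕ} (hR : ∀ p ∈ R, p.Prime) {w : ℕ} (hw : 2 ≤ w)
    (hRw : ∀ p ∈ R, p ≤ w) {x m J : ℕ} (hm : 0 < m) (hmx : m ≤ x) (hJ : x / m < w ^ (J + 1)) :
    ((#R : ℝ) / w) ^ J / J.factorial * (x / (m * w)) ≤ #(factoredUpTo R (x / m)) := by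
  set z := x / m with hz
  set j := Nat.log w z with hj
  have hz0 : z ≠ 0 := (Nat.div_pos hmx hm).ne'
  have hw1 : 1 < w := hw
  have hw0 : (0 : ℝ) < w := by exact_mod_cast (zero_lt_two.trans_le hw)
  -- `w ^ j ≤ z < w ^ (j + 1)`
  have hwj : w ^ j ≤ z := Nat.pow_log_le_self w hz0
  have hzj : z < w ^ (j + 1) := Nat.lt_pow_succ_log_self hw1 z
  -- `j ≤ J`
  have hjJ : j ≤ J := by
    have : w ^ j < w ^ (J + 1) := lt_of_le_of_lt hwj hJ
    exact Nat.lt_succ_iff.1 ((Nat.pow_lt_pow_iff_right hw1).1 this)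
  -- the count: `q ^ j ≤ j! * ψ(z; R)`
  have hcount : ((#R : ℕ) : ℝ) ^ j ≤ (j.factorial : ℝ) * #(factoredUpTo R z) :=
    (card_pow_le_factorial_mul_card_sym R j).trans
      (mul_le_mul_of_nonneg_left
        (by exact_mod_cast card_sym_le_card_factoredUpTo_of_pow_le hR hRw hwj)
        (Nat.cast_nonneg _))
  -- `x / (m w) < w ^ j` in `ℝ`: from `z < w^(j+1)`, `(z + 1) * m > x`
  have hxmw : (x : ℝ) / (m * w) ≤ (w : ℝ) ^ j := by
    have h1 : x < (z + 1) * m := by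
      have := Nat.lt_div_mul_add (a := x) hm
      rw [hz]
      linarith [this]
    have h2 : (z + 1) * m ≤ w ^ (j + 1) * m := Nat.mul_le_mul_right m hzj
    have h3 : (x : ℝ) < (w : ℝ) ^ (j + 1) * m := by exact_mod_cast h1.trans_le h2
    have hm0 : (0 : ℝ) < m := by exact_mod_cast hm
    rw [div_le_iff₀ (mul_pos hm0 hw0)]
    rw [pow_succ] at h3
    nlinarith [h3]
  -- `(q/w)^J / J! ≤ (q/w)^j / j!`
  have hq1 : (#R : ℝ) / w ≤ 1 := by
    rw [div_le_one hw0]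
    exact_mod_cast card_le_of_forall_prime_le hR hRw
  have hq0 : (0 : ℝ) ≤ (#R : ℝ) / w := div_nonneg (Nat.cast_nonneg _) hw0.le
  have hmono : ((#R : ℝ) / w) ^ J / J.factorial ≤ ((#R : ℝ) / w) ^ j / j.factorial := by
    have hf : (j.factorial : ℝ) ≤ J.factorial := by exact_mod_cast Nat.factorial_le hjJ
    have hjpos : (0 : ℝ) < j.factorial := by exact_mod_cast j.factorial_pos
    exact div_le_div₀ (pow_nonneg hq0 _) (pow_le_pow_of_le_one hq0 hq1 hjJ) hjpos hf
  -- assemble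
  have hjpos : (0 : ℝ) < j.factorial := by exact_mod_cast j.factorial_pos
  calc ((#R : ℝ) / w) ^ J / J.factorial * (x / (m * w))
      ≤ ((#R : ℝ) / w) ^ j / j.factorial * (w : ℝ) ^ j :=
        mul_le_mul hmono hxmw (by positivity) (by positivity)
    _ = ((#R : ℕ) : ℝ) ^ j / j.factorial := by
        rw [div_pow, div_div, div_mul_eq_mul_div, div_eq_div_iff (by positivity) hjpos.ne']
        ring
    _ ≤ #(factoredUpTo R z) := by
        rw [div_le_iff₀ hjpos, mul_comm]
        exact hcount

/-- **Lenstra–Pomerance's Theorem 6.1, combinatorial form.** Let `R, T ⊆ Q` be finite sets of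
primes with `R ∩ T = ∅`, every prime of `R` at most `w` (`w ≥ 2`), every prime of `T` in `[v, y]`
(`v ≥ 1`), and let `k, J, x` be integers with `y ^ k ≤ x < v ^ k · w ^ (J + 1)`. Then, with
`S = ∑_{p ∈ T} 1/p` and `q = #R`,

  `x · S^k · (q / w)^J / (w · J! · k!) ≤ ψ(x; Q)`,

`ψ(x; Q) = #(factoredUpTo Q x)` being the number of `1 ≤ n ≤ x` all of whose prime factors lie in
`Q`. In the paper `Q = {p ≤ y : p ∈ 𝒫}`, `T = {p ∈ 𝒫 : v < p ≤ y}`, `R = {p ∈ 𝒫 : p ≤ w}`,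
`k = [u]`, `u = log x / log y`, and under (6.4) (`S ≥ 1/(α log u)`, `q ≥ w / (β log w)`) the
right-hand side is `x · exp(-u(log u + log log u + log α + o(log u)))` for
`y ≤ exp((log x)^{1/2} (log log x)^η)`, which is the printed Theorem 6.1; the present statement is
its non-asymptotic core (6.6)–(6.11), valid for every finite set of primes.
[cite: LenstraPomerance1992, §6 Thm 6.1 and its proof (6.6)–(6.11)] -/
theorem card_factoredUpTo_ge {Q R T : Finset ℕ} (hR : ∀ p ∈ R, p.Prime)
    (hT : ∀ p ∈ T, p.Prime) (hRQ : R ⊆ Q) (hTQ : T ⊆ Q) (hRT : Disjoint R T) {w v y k x J : ℕ}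
    (hw : 2 ≤ w) (hRw : ∀ p ∈ R, p ≤ w) (hv : 0 < v) (hTv : ∀ p ∈ T, v ≤ p)
    (hTy : ∀ p ∈ T, p ≤ y) (hx : y ^ k ≤ x) (hJ : x < v ^ k * w ^ (J + 1)) :
    (x : ℝ) * (∑ p ∈ T, (p : ℝ)⁻¹) ^ k * ((#R : ℝ) / w) ^ J /
        (w * J.factorial * k.factorial) ≤ #(factoredUpTo Q x) := by
  have hw0 : (0 : ℝ) < w := by exact_mod_cast (zero_lt_two.trans_le hw)
  have hkpos : (0 : ℝ) < k.factorial := by exact_mod_cast k.factorial_pos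
  have hJpos : (0 : ℝ) < J.factorial := by exact_mod_cast J.factorial_pos
  -- the per-`M` bound, summed
  have hsum : ∑ M ∈ T.sym k, ((#R : ℝ) / w) ^ J / J.factorial *
      (x / ((((M : Multiset ℕ).prod : ℕ) : ℝ) * w)) ≤
      ∑ M ∈ T.sym k, (#(factoredUpTo R (x / (M : Multiset ℕ).prod)) : ℝ) := by
    refine sum_le_sum fun M hM => ?_
    have hm0 : 0 < (M : Multiset ℕ).prod := Nat.pos_of_ne_zero (sym_prod_ne_zero hT hM)
    have hmx : (M : Multiset ℕ).prod ≤ x := (sym_prod_le_pow hTy hM).trans hx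
    have hvm : v ^ k ≤ (M : Multiset ℕ).prod := pow_le_sym_prod hTv hM
    have hJ' : x / (M : Multiset ℕ).prod < w ^ (J + 1) := by
      have h1 : x / (M : Multiset ℕ).prod ≤ x / v ^ k := Nat.div_le_div_left hvm (pow_pos hv k)
      have h2 : x / v ^ k < w ^ (J + 1) := (Nat.div_lt_iff_lt_mul (pow_pos hv k)).2 (by
        simpa [mul_comm] using hJ)
      exact h1.trans_lt h2
    exact card_factoredUpTo_div_ge hR hw hRw hm0 hmx hJ'
  -- `∑_M 1/∏M ≥ S^k / k!`
  have hS := inv_sum_pow_le_factorial_mul_sum_sym_inv_prod T k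
  -- the two-stage injection
  have hinj : ∑ M ∈ T.sym k, (#(factoredUpTo R (x / (M : Multiset ℕ).prod)) : ℝ) ≤
      #(factoredUpTo Q x) := by
    exact_mod_cast sum_card_factoredUpTo_div_le hT hTQ hRQ hRT x k
  -- assemble
  have hC : 0 ≤ ((#R : ℝ) / w) ^ J / J.factorial * ((x : ℝ) / w) := by positivity
  calc (x : ℝ) * (∑ p ∈ T, (p : ℝ)⁻¹) ^ k * ((#R : ℝ) / w) ^ J / (w * J.factorial * k.factorial)
      = ((#R : ℝ) / w) ^ J / J.factorial * ((x : ℝ) / w) *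
          ((∑ p ∈ T, (p : ℝ)⁻¹) ^ k / k.factorial) := by
        field_simp
    _ ≤ ((#R : ℝ) / w) ^ J / J.factorial * ((x : ℝ) / w) *
          ∑ M ∈ T.sym k, ((((M : Multiset ℕ).prod : ℕ) : ℝ))⁻¹ := by
        refine mul_le_mul_of_nonneg_left ?_ hC
        rw [div_le_iff₀ hkpos, mul_comm]
        exact hS
    _ = ∑ M ∈ T.sym k, ((#R : ℝ) / w) ^ J / J.factorial *
          (x / ((((M : Multiset ℕ).prod : ℕ) : ℝ) * w)) := by
        rw [mul_sum]
        refine sum_congr rfl fun M _ => ?_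
        rw [mul_assoc]
        congr 1
        rw [div_mul_eq_mul_div, ← div_eq_mul_inv, div_div]
    _ ≤ ∑ M ∈ T.sym k, (#(factoredUpTo R (x / (M : Multiset ℕ).prod)) : ℝ) := hsum
    _ ≤ #(factoredUpTo Q x) := hinj

/-- **Theorem 6.1 for the paper's interval sets.** For a finite set `Q` of primes all `≤ y`
(think `Q = {p ≤ y : p ∈ 𝒫}`), thresholds `2 ≤ w ≤ v` and integers with
`y ^ k ≤ x < v ^ k · w ^ (J + 1)`:
`x · S^k · (q/w)^J / (w · J! · k!) ≤ ψ(x; Q)` with `S = ∑_{p ∈ Q, v < p} 1/p` (the paper's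
`S(v, y; 𝒫)`) and `q = #{p ∈ Q : p ≤ w}` (the paper's `π(w; 𝒫)`).
[cite: LenstraPomerance1992, §6 Thm 6.1] -/
theorem card_factoredUpTo_ge_of_filter {Q : Finset ℕ} (hQ : ∀ p ∈ Q, p.Prime) {w v y k x J : ℕ}
    (hw : 2 ≤ w) (hwv : w ≤ v) (hQy : ∀ p ∈ Q, p ≤ y) (hx : y ^ k ≤ x)
    (hJ : x < v ^ k * w ^ (J + 1)) :
    (x : ℝ) * (∑ p ∈ Q with v < p, (p : ℝ)⁻¹) ^ k * ((#{p ∈ Q | p ≤ w} : ℝ) / w) ^ J /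
        (w * J.factorial * k.factorial) ≤ #(factoredUpTo Q x) := by
  refine card_factoredUpTo_ge (R := {p ∈ Q | p ≤ w}) (T := {p ∈ Q | v < p})
    (fun p hp => hQ p (mem_filter.1 hp).1) (fun p hp => hQ p (mem_filter.1 hp).1)
    (filter_subset _ _) (filter_subset _ _) ?_ hw (fun p hp => (mem_filter.1 hp).2)
    (zero_lt_two.trans_le (hw.trans hwv)) (fun p hp => (mem_filter.1 hp).2.le)
    (fun p hp => hQy p (mem_filter.1 hp).1) hx hJ
  rw [disjoint_left]
  intro p hp hp'
  have h1 := (mem_filter.1 hp).2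
  have h2 := (mem_filter.1 hp').2
  omega

end Literature.NumberTheory.Sieve
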